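import Summits.PneNP.PneNP.Theorems.PhaseTwinsPolyDepthTwinsAboveAcDefs
import Summits.PneNP.PneNP.Theorems.PhaseTwinsPolyDepthTwinsAboveConnector

/-!
# Route PhaseTwins, crux `PolyDepthTwinsAbove` (stmt-PneNP-2719), line `annealed-cover-twins`:
# `stub_annealedConnector`, part 1 — the annealed partition function by families of port patterns

Sly's Lemma 2.2 bookkeeping for the cover-wired CFI graph `acGraph R P τ S c` of the line
`annealed-cover-twins` (definitions `PhaseTwinsPolyDepthTwinsAboveAcDefs`), combinatorial half:

* `isIndepSet_acGraph_iff` — a configuration is independent iff its fibre over every CANONICAL dart is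
  independent in the cover gadget of that dart (non-canonical darts carry isolated junk), every occupied
  END `(w, i, a, j)` plugs into a VACANT port vertex `acPort R P (w, i, a, j)` — layer `a`, port index
  `P (s, j)` of the gadget `(δ, s) = canonEnd R (w, i)` — and the CFI adjacency holds in every complex;
* `indepPoly_acGraph_eq_sum` — for ONE gadget sample `S`, `Z(acGraph S c)` grouped by the gadget part:
  the complex parts sum to `acWc c (patterns)`, the product over the complexes `(w, j)` of the local
  factors `cxWeight (c w) λ x` at the vacancy indicators of the ports (`sum_cxPart_eq_prod` of the sibling
  line `parity-wired-ports`);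
* `annZ_eq_sum_pat` — summing the gadget samples INSIDE this decomposition the gadgets factor, exactly:
  `Σ_S Z(acGraph S c) = Σ_{k : Dart → PortPat} (Π_δ acGG δ (k δ)) · acWc c k`, where `acGG δ` is the
  annealed restricted partition function `gadG` of the line at a canonical dart and `|GSample| · junkG`
  (all subsets of an edgeless fibre, by port pattern) at a non-canonical one.
No hypothesis on the base is used here. (Part 2, `…AcConnectorExpect`: the pattern sum under the
mixture of product laws; part 3, `…AcConnector`: the stub.) [cite: Sly2010, Lemma 2.2 (proof); folklore
bookkeeping]
-/

noncomputable section

open scoped Classical BigOperators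

namespace Summit.PneNP.PneNP.Cruxes.PolyDepthTwinsAbove.AnnealedCoverTwins

open Finset
open Summit.PneNP.PneNP.Cruxes.PolyDepthTwinsAbove.ParityWiredPorts (PWVert canonEnd cxWeight sum_eq_sum_fib
  card_eq_sum_card_fib sum_cxPart_eq_prod sum_finset_disjSum ite_congr_of_iff)
open Literature.Computability.Complexity (hardcoreZOn hardcoreZOn_def SlyReduction.isIndepSet_coe_finset_iff)
open Literature.Computability.Complexity.Expander (RotGraph)
open Literature.ModelTheory.FiniteModelTheory.TseitinColouring (Dart)
open Literature.ModelTheory.FiniteModelTheory.CFIMatching (bit Canon)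
open Literature.Probability.LatticeModels (independencePolynomial)

set_option linter.dupNamespace false

variable {M n' κ dm : ℕ}

/-! ## Pattern-level objects -/

/-- The GADGET VERTEX an end plugs into: the end `(w, i, a, j)` is adjacent exactly to the port vertex
`(δ, a, P (s, j))` of the gadget `(δ, s) = canonEnd R (w, i)` (`acRel`, end–gadget clause). -/
def acPort (R : RotGraph M 3) (P : Fin 2 × Fin κ ↪ Fin n') (e : Fin M × Fin 3 × ZMod 2 × Fin κ) :
    Dart M 3 × ZMod 2 × Fin n' :=
  ((canonEnd R (e.1, e.2.1)).1, e.2.2.1, P ((canonEnd R (e.1, e.2.1)).2, e.2.2.2))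

/-- The configuration on the gadget of the dart `δ`: its fibre. -/
def gadFib (I : Finset (PWVert M n' κ)) (δ : Dart M 3) : Finset (ZMod 2 × Fin n') :=
  univ.filter fun x => (Sum.inl (δ, x) : PWVert M n' κ) ∈ I

/-- **The complex factor of a family of port patterns** `k` (one pattern per dart; only the patterns of
the gadgets `(canonEnd R (w, i)).1` are read): the product over the complexes `(w, j)` of the local factor
`cxWeight (c w) λ x` at the VACANCY INDICATORS `x (i, a) ∈ {0, 1}` of the port vertex the end `(w, i, a, j)`
plugs into (layer `a`, port index `P (s, j)` of the gadget `(δ, s) = canonEnd R (w, i)`). -/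
def acWc (R : RotGraph M 3) (lam : ℝ) (c : Fin M → ZMod 2) (k : Dart M 3 → PortPat κ) : ℝ :=
  ∏ q : Fin M × Fin κ, cxWeight (c q.1) lam fun l =>
    if k (canonEnd R (q.1, l.1)).1 (((canonEnd R (q.1, l.1)).2, q.2), l.2) then 0 else 1

/-- **Junk partition function by port pattern**: the total `λ`-weight of ALL subsets of the vertex set of one
gadget with port pattern `k` (the fibre over a NON-canonical dart is unconstrained: isolated vertices). -/
def junkG (P : Fin 2 × Fin κ ↪ Fin n') (lam : ℝ) (k : PortPat κ) : ℝ :=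
  ∑ J : Finset (ZMod 2 × Fin n'), if gadPat P J = k then lam ^ J.card else 0

/-- **The effective annealed restricted partition function of the gadget at dart `δ`**, by port pattern:
`G(k)` (`gadG`) at a canonical dart, `|GSample| · junkG k` at a non-canonical one. -/
def acGG (R : RotGraph M 3) (P : Fin 2 × Fin κ ↪ Fin n') (τ : Equiv.Perm (Fin n')) (dm : ℕ) (lam : ℝ)
    (δ : Dart M 3) (k : PortPat κ) : ℝ :=
  if Canon R δ then gadG P τ dm lam k else (GSample n' dm).card * junkG P lam k

/-! ## Independence in the cover-wired graph -/

/-- Membership in a gadget fibre. -/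
theorem mem_gadFib (I : Finset (PWVert M n' κ)) (δ : Dart M 3) (x : ZMod 2 × Fin n') :
    x ∈ gadFib I δ ↔ (Sum.inl (δ, x) : PWVert M n' κ) ∈ I := by
  simp [gadFib]

/-- Inside an admissible configuration the generating relation `acRel` never holds. -/
theorem not_acRel_of_conditions (R : RotGraph M 3) (P : Fin 2 × Fin κ ↪ Fin n') (τ : Equiv.Perm (Fin n'))
    (S : Dart M 3 → Fin dm → Equiv.Perm (Fin n')) (c : Fin M → ZMod 2) (I : Finset (PWVert M n' κ))
    (h1 : ∀ δ : Dart M 3, Canon R δ →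
      (gadGraph τ (S δ)).IsIndepSet (↑(gadFib I δ) : Set (ZMod 2 × Fin n')))
    (h2 : ∀ e : Fin M × Fin 3 × ZMod 2 × Fin κ, (Sum.inr (Sum.inl e) : PWVert M n' κ) ∈ I →
      (Sum.inl (acPort R P e) : PWVert M n' κ) ∉ I)
    (h3 : ∀ (w : Fin M) (S' : Fin 2 → ZMod 2) (j : Fin κ),
      (Sum.inr (Sum.inr (w, S', j)) : PWVert M n' κ) ∈ I →
        ∀ i : Fin 3, (Sum.inr (Sum.inl (w, i, bit (c w) S' i, j)) : PWVert M n' κ) ∉ I)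
    {a b : PWVert M n' κ} (ha : a ∈ I) (hb : b ∈ I) (hr : acRel R P τ S c a b) : False := by
  rcases a with ⟨δ, e, x⟩ | ⟨w, i, e, j⟩ | ⟨w, S', j⟩ <;>
    rcases b with ⟨δ', e', y⟩ | ⟨w', i', e', j'⟩ | ⟨w', S'', j'⟩ <;>
    simp only [acRel] at hr
  · -- gadget / gadget
    obtain ⟨hC, h₁, h₂, hxy, hh⟩ := hr
    rw [h₁] at hb
    have hadj : (gadGraph τ (S δ)).Adj (e, x) (e', y) := by
      rw [gadGraph_adj]
      refine ⟨fun h => hxy ?_, Or.inl ⟨h₂, hxy, hh⟩⟩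
      simpa using congrArg Prod.snd h
    exact (SlyReduction.isIndepSet_coe_finset_iff _ _).1 (h1 δ hC) (e, x)
      ((mem_gadFib I δ (e, x)).2 ha) (e', y) ((mem_gadFib I δ (e', y)).2 hb) hadj
  · -- end / gadget
    obtain ⟨h₁, h₂, h₃⟩ := hr
    rw [h₁, h₂, h₃] at hb
    exact h2 (w, i, e, j) ha hb
  · -- inner / end
    obtain ⟨h₁, h₂, h₃⟩ := hr
    rw [h₁, h₂, ← h₃] at hb
    exact h3 w S' j ha i' hb

/-- **Independent sets of the cover-wired graph**: the fibre over every CANONICAL dart independent in its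
cover gadget (non-canonical darts impose nothing), every occupied END plugged into a vacant port vertex, and
the CFI adjacency respected inside every complex. -/
theorem isIndepSet_acGraph_iff (R : RotGraph M 3) (P : Fin 2 × Fin κ ↪ Fin n') (τ : Equiv.Perm (Fin n'))
    (S : Dart M 3 → Fin dm → Equiv.Perm (Fin n')) (c : Fin M → ZMod 2) (I : Finset (PWVert M n' κ)) :
    (acGraph R P τ S c).IsIndepSet (↑I : Set (PWVert M n' κ)) ↔
      (∀ δ : Dart M 3, Canon R δ →
        (gadGraph τ (S δ)).IsIndepSet (↑(gadFib I δ) : Set (ZMod 2 × Fin n'))) ∧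
      (∀ e : Fin M × Fin 3 × ZMod 2 × Fin κ, (Sum.inr (Sum.inl e) : PWVert M n' κ) ∈ I →
        (Sum.inl (acPort R P e) : PWVert M n' κ) ∉ I) ∧
      (∀ (w : Fin M) (S' : Fin 2 → ZMod 2) (j : Fin κ),
        (Sum.inr (Sum.inr (w, S', j)) : PWVert M n' κ) ∈ I →
          ∀ i : Fin 3, (Sum.inr (Sum.inl (w, i, bit (c w) S' i, j)) : PWVert M n' κ) ∉ I) := by
  rw [SlyReduction.isIndepSet_coe_finset_iff]
  constructor
  · intro h
    refine ⟨fun δ hδ => ?_, fun e he hp => ?_, fun w S' j hS i hi => ?_⟩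
    · rw [SlyReduction.isIndepSet_coe_finset_iff]
      rintro ⟨a, x⟩ hx ⟨b, y⟩ hy hxy
      rw [mem_gadFib] at hx hy
      refine h _ hx _ hy ?_
      rw [gadGraph_adj] at hxy
      obtain ⟨hne, hh | hh⟩ := hxy
      · obtain ⟨h₁, h₂, h₃⟩ := hh
        rw [acGraph_adj]
        exact ⟨fun heq => hne (by simpa using heq), Or.inl ⟨hδ, rfl, h₁, h₂, h₃⟩⟩
      · obtain ⟨h₁, h₂, h₃⟩ := hh
        rw [acGraph_adj]
        exact ⟨fun heq => hne (by simpa using heq), Or.inr ⟨hδ, rfl, h₁, h₂, h₃⟩⟩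
    · obtain ⟨w, i, a, j⟩ := e
      refine h _ he _ hp ?_
      rw [acGraph_adj]
      exact ⟨by simp, Or.inl ⟨rfl, rfl, rfl⟩⟩
    · refine h _ hS _ hi ?_
      rw [acGraph_adj]
      exact ⟨by simp, Or.inl ⟨rfl, rfl, rfl⟩⟩
  · rintro ⟨h1, h2, h3⟩ a ha b hb hab
    rw [acGraph_adj] at hab
    obtain ⟨-, hr | hr⟩ := hab
    · exact not_acRel_of_conditions R P τ S c I h1 h2 h3 ha hb hr
    · exact not_acRel_of_conditions R P τ S c I h1 h2 h3 hb ha hr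

/-! ## The partition function of one sample, grouped by the gadget part -/

/-- The gadget fibres of a split configuration only see the gadget part. -/
theorem gadFib_disjSum (I₁ : Finset (Dart M 3 × ZMod 2 × Fin n'))
    (I₂ : Finset ((Fin M × Fin 3 × ZMod 2 × Fin κ) ⊕ (Fin M × (Fin 2 → ZMod 2) × Fin κ))) (δ : Dart M 3) :
    gadFib (I₁.disjSum I₂) δ = univ.filter fun x => (δ, x) ∈ I₁ := by
  ext x
  simp [gadFib, Finset.inl_mem_disjSum]

/-- The independence event of a split configuration, in terms of its gadget part `I₁` and its complex
part `I₂`. -/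
theorem indep_disjSum_iff (R : RotGraph M 3) (P : Fin 2 × Fin κ ↪ Fin n') (τ : Equiv.Perm (Fin n'))
    (S : Dart M 3 → Fin dm → Equiv.Perm (Fin n')) (c : Fin M → ZMod 2)
    (I₁ : Finset (Dart M 3 × ZMod 2 × Fin n'))
    (I₂ : Finset ((Fin M × Fin 3 × ZMod 2 × Fin κ) ⊕ (Fin M × (Fin 2 → ZMod 2) × Fin κ))) :
    (acGraph R P τ S c).IsIndepSet (↑(I₁.disjSum I₂) : Set (PWVert M n' κ)) ↔
      (∀ δ : Dart M 3, Canon R δ → (gadGraph τ (S δ)).IsIndepSet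
        (↑(univ.filter fun x : ZMod 2 × Fin n' => (δ, x) ∈ I₁) : Set (ZMod 2 × Fin n'))) ∧
      (∀ e : Fin M × Fin 3 × ZMod 2 × Fin κ, Sum.inl e ∈ I₂ → ¬ (acPort R P e ∈ I₁)) ∧
      (∀ (w : Fin M) (S' : Fin 2 → ZMod 2) (j : Fin κ), Sum.inr (w, S', j) ∈ I₂ →
        ∀ i : Fin 3, Sum.inl (w, i, bit (c w) S' i, j) ∉ I₂) := by
  rw [isIndepSet_acGraph_iff]
  simp only [gadFib_disjSum, Finset.inl_mem_disjSum, Finset.inr_mem_disjSum]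

/-- **`Z(acGraph R P τ S c; λ)` grouped by the gadget part** (Sly's Lemma 2.2, second display, for the
cover wiring): split a configuration into its gadget part — a family `J` of gadget fibres — and its complex
part, and sum the complex parts given the gadget part (`sum_cxPart_eq_prod`):
`Z = Σ_J (Π_δ [Canon δ → J δ independent in the gadget of S δ] λ^{|J δ|}) · acWc (patterns of J)`. -/
theorem indepPoly_acGraph_eq_sum (R : RotGraph M 3) (P : Fin 2 × Fin κ ↪ Fin n') (τ : Equiv.Perm (Fin n'))
    (S : Dart M 3 → Fin dm → Equiv.Perm (Fin n')) (c : Fin M → ZMod 2) (lam : ℝ) :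
    independencePolynomial (acGraph R P τ S c) lam =
      ∑ J : Dart M 3 → Finset (ZMod 2 × Fin n'),
        (∏ δ, if (Canon R δ → (gadGraph τ (S δ)).IsIndepSet (↑(J δ) : Set (ZMod 2 × Fin n')))
          then lam ^ (J δ).card else 0) * acWc R lam c (fun δ => gadPat P (J δ)) := by
  unfold independencePolynomial
  rw [sum_finset_disjSum]
  rw [← sum_eq_sum_fib (fun J : Dart M 3 → Finset (ZMod 2 × Fin n') =>
    (∏ δ, if (Canon R δ → (gadGraph τ (S δ)).IsIndepSet (↑(J δ) : Set (ZMod 2 × Fin n')))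
      then lam ^ (J δ).card else 0) * acWc R lam c (fun δ => gadPat P (J δ)))]
  refine sum_congr rfl fun I₁ _ => ?_
  -- the complex parts, given the gadget part
  have hcx := sum_cxPart_eq_prod c lam (fun e => acPort R P e ∈ I₁)
  -- the vacancy indicators are those of `acWc` at the patterns of the fibres
  have hW : (∏ q : Fin M × Fin κ, cxWeight (c q.1) lam fun l =>
      if acPort R P (q.1, l.1, l.2, q.2) ∈ I₁ then 0 else 1) =
      acWc R lam c (fun δ => gadPat P (univ.filter fun x : ZMod 2 × Fin n' => (δ, x) ∈ I₁)) := by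
    unfold acWc
    refine prod_congr rfl fun q _ => ?_
    congr 1
    funext l
    refine ite_congr_of_iff ?_ 0 1
    simp only [acPort, gadPat, decide_eq_true_eq, mem_filter, mem_univ, true_and]
  -- the gadget indicator factorises over the darts
  have hG : ∀ X : ℝ, (if ∀ δ : Dart M 3, Canon R δ → (gadGraph τ (S δ)).IsIndepSet
        (↑(univ.filter fun x : ZMod 2 × Fin n' => (δ, x) ∈ I₁) : Set (ZMod 2 × Fin n'))
      then lam ^ I₁.card * X else 0) =
      (∏ δ, if (Canon R δ → (gadGraph τ (S δ)).IsIndepSet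
          (↑(univ.filter fun x : ZMod 2 × Fin n' => (δ, x) ∈ I₁) : Set (ZMod 2 × Fin n')))
        then lam ^ (univ.filter fun x : ZMod 2 × Fin n' => (δ, x) ∈ I₁).card else 0) * X := by
    intro X
    split_ifs with h
    · rw [card_eq_sum_card_fib I₁, ← prod_pow_eq_pow_sum]
      congr 1
      refine prod_congr rfl fun δ _ => ?_
      rw [if_pos (h δ)]
    · obtain ⟨δ, hδ⟩ := not_forall.1 h
      symm
      apply mul_eq_zero_of_left
      exact prod_eq_zero (mem_univ δ) (if_neg hδ)
  rw [← hW, ← hcx, ← hG]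
  -- compare the two indicator sums termwise
  have hkey := indep_disjSum_iff R P τ S c I₁
  split_ifs with hA
  · rw [mul_sum]
    refine sum_congr rfl fun I₂ _ => ?_
    by_cases hB : (∀ e : Fin M × Fin 3 × ZMod 2 × Fin κ, Sum.inl e ∈ I₂ → ¬ (acPort R P e ∈ I₁)) ∧
        ∀ (w : Fin M) (S' : Fin 2 → ZMod 2) (j : Fin κ), Sum.inr (w, S', j) ∈ I₂ →
          ∀ i : Fin 3, Sum.inl (w, i, bit (c w) S' i, j) ∉ I₂
    · rw [if_pos hB, if_pos ((hkey I₂).2 ⟨hA, hB⟩), card_disjSum, pow_add]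
    · rw [if_neg hB, mul_zero, if_neg (fun h => hB ((hkey I₂).1 h).2)]
  · exact sum_eq_zero fun I₂ _ => if_neg fun h => hA ((hkey I₂).1 h).1

/-! ## The annealed partition function as a sum over families of port patterns -/

/-- Summing the gadget factor of dart `δ` over the gadget samples and over the fibre of a port pattern
gives the effective restricted partition function `acGG`. -/
theorem sum_filter_gadPat_eq_acGG (R : RotGraph M 3) (P : Fin 2 × Fin κ ↪ Fin n') (τ : Equiv.Perm (Fin n'))
    (dm : ℕ) (lam : ℝ) (δ : Dart M 3) (k : PortPat κ) :
    ∑ J ∈ univ.filter (fun J : Finset (ZMod 2 × Fin n') => gadPat P J = k),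
      ∑ σ ∈ GSample n' dm, (if (Canon R δ → (gadGraph τ σ).IsIndepSet (↑J : Set (ZMod 2 × Fin n')))
        then lam ^ J.card else (0 : ℝ)) = acGG R P τ dm lam δ k := by
  rw [sum_comm]
  unfold acGG
  by_cases hC : Canon R δ
  · rw [if_pos hC]
    unfold gadG
    refine sum_congr rfl fun σ _ => ?_
    rw [hardcoreZOn_def, sum_filter]
    refine sum_congr rfl fun J _ => ?_
    by_cases hk : gadPat P J = k
    · rw [if_pos hk]
      by_cases hI : (gadGraph τ σ).IsIndepSet (↑J : Set (ZMod 2 × Fin n'))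
      · rw [if_pos (fun _ => hI), if_pos ⟨hI, hk⟩]
      · rw [if_neg (fun h => hI (h hC)), if_neg (fun h => hI h.1)]
    · rw [if_neg hk, if_neg (fun h => hk h.2)]
  · rw [if_neg hC]
    have h1 : ∀ (σ : Fin dm → Equiv.Perm (Fin n')) (J : Finset (ZMod 2 × Fin n')),
        (if (Canon R δ → (gadGraph τ σ).IsIndepSet (↑J : Set (ZMod 2 × Fin n'))) then lam ^ J.card
          else (0 : ℝ)) = lam ^ J.card := fun σ J => if_pos (fun h => absurd h hC)
    simp_rw [h1]
    rw [sum_const, nsmul_eq_mul]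
    unfold junkG
    rw [sum_filter]

/-- The fibre of a family of port patterns is a box. -/
theorem filter_pat_eq_piFinset (P : Fin 2 × Fin κ ↪ Fin n') (k : Dart M 3 → PortPat κ) :
    (univ.filter fun J : Dart M 3 → Finset (ZMod 2 × Fin n') => (fun δ => gadPat P (J δ)) = k) =
      Fintype.piFinset fun δ => univ.filter fun J' : Finset (ZMod 2 × Fin n') => gadPat P J' = k δ := by
  ext J
  simp only [mem_filter, mem_univ, true_and, Fintype.mem_piFinset, funext_iff]

/-- **The annealed partition function as a sum over families of port patterns** (exact): summing the
gadget samples INSIDE the fibre decomposition, the gadgets factor —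
`Σ_S Z(acGraph S c) = Σ_k (Π_δ acGG δ (k δ)) · acWc c k`. -/
theorem annZ_eq_sum_pat (R : RotGraph M 3) (P : Fin 2 × Fin κ ↪ Fin n') (τ : Equiv.Perm (Fin n'))
    (dm : ℕ) (c : Fin M → ZMod 2) (lam : ℝ) :
    annZ R P τ dm c lam =
      ∑ k : Dart M 3 → PortPat κ, (∏ δ, acGG R P τ dm lam δ (k δ)) * acWc R lam c k := by
  unfold annZ
  simp_rw [indepPoly_acGraph_eq_sum]
  rw [sum_comm]
  simp_rw [← sum_mul]
  have h2 : ∀ J : Dart M 3 → Finset (ZMod 2 × Fin n'),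
      ∑ S ∈ Fintype.piFinset (fun _ : Dart M 3 => GSample n' dm),
        ∏ δ, (if (Canon R δ → (gadGraph τ (S δ)).IsIndepSet (↑(J δ) : Set (ZMod 2 × Fin n')))
          then lam ^ (J δ).card else (0 : ℝ)) =
      ∏ δ, ∑ σ ∈ GSample n' dm, (if (Canon R δ → (gadGraph τ σ).IsIndepSet (↑(J δ) : Set (ZMod 2 × Fin n')))
          then lam ^ (J δ).card else (0 : ℝ)) := fun J =>
    Finset.sum_prod_piFinset (GSample n' dm) (fun δ σ =>
      if (Canon R δ → (gadGraph τ σ).IsIndepSet (↑(J δ) : Set (ZMod 2 × Fin n'))) then lam ^ (J δ).card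
        else (0 : ℝ))
  simp_rw [h2]
  -- group the families of fibres by their families of port patterns
  rw [← Finset.sum_fiberwise univ (fun J : Dart M 3 → Finset (ZMod 2 × Fin n') => fun δ => gadPat P (J δ))]
  refine sum_congr rfl fun k _ => ?_
  rw [sum_congr rfl fun J hJ => by rw [(mem_filter.1 hJ).2], ← sum_mul]
  congr 1
  rw [filter_pat_eq_piFinset,
    ← Finset.prod_univ_sum (fun δ => univ.filter fun J' : Finset (ZMod 2 × Fin n') => gadPat P J' = k δ)
      (fun δ J' => ∑ σ ∈ GSample n' dm,
        if (Canon R δ → (gadGraph τ σ).IsIndepSet (↑J' : Set (ZMod 2 × Fin n'))) then lam ^ J'.card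
          else (0 : ℝ))]
  exact prod_congr rfl fun δ _ => sum_filter_gadPat_eq_acGG R P τ dm lam δ (k δ)

end Summit.PneNP.PneNP.Cruxes.PolyDepthTwinsAbove.AnnealedCoverTwins
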